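import Literature.ModelTheory.ExponentialFields.PilaWilkieParametrizationTools
import Literature.ModelTheory.ExponentialFields.PilaWilkieUnaryParametrizationCr
import HarnessLib

/-!
# The uniform `r`-reparametrization property in dimensions `0` and `1` (Pila–Wilkie 2006, §5, `(I)_0`, `(I)_1`)

Topic `Literature/ModelTheory/ExponentialFields`; proof file in the cone of the named fact
`PilaWilkie2006_thm_1_8`.  The uniform `r`-reparametrization property `UR(r, ℓ)` of
`ℓ`-variable definable families (the uniform-in-parameters form of Pila–Wilkie's `(I)_ℓ`,
spelled out inline exactly as consumed by `cellFibreParam`): for definable families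
`F_l(v, ·) : (0,1)^ℓ → [-1, 1]` there are finitely many definable families of charts
`ψ_j(v, ·) : (0,1)^ℓ → (0,1)^ℓ`, covering, `C^r` with all Fréchet derivatives `≤ 1`, such
that all `F_l(v, ·) ∘ ψ_j(v, ·)` are `C^r` with all Fréchet derivatives `≤ 1`.

* `uniformReparam_zero` — `UR(r, 0)` (*"`(I)_0` … trivial"*);
* `uniformReparam_one` — `UR(r, 1)` for `r ≥ 1`, from `uniform_r_parametrization` (the
  uniform unary `r`-parametrization, Pila–Wilkie 2006, Cor. 3.6/5.1; Wilkie 2015, Thm. 5.7)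
  via the `1`-cube plumbing `contDiffOn_norm_iteratedFDeriv_le_of_unary`.

Nothing here is a named fact; no definitions.

## References

* J. Pila, A. J. Wilkie, *The rational points of a definable set*, Duke Math. J. 133 (2006),
  §3 (Cor. 3.6), §5. [PilaWilkie2006]
* A. J. Wilkie, *Rational points on definable sets*, LMS LNS 421 (2015), Thm. 5.7. [Wilkie2015]
-/

noncomputable section

open Set FirstOrder FirstOrder.Language Filter Topology

namespace Literature.ModelTheory.ExponentialFields

/-! ### The uniform `r`-reparametrization property `UR(r, ℓ)` for `ℓ = 0, 1` -/

section Low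

open Classical

variable {L : Language} [L.Structure ℝ]

/-- **`UR(r, 0)`** (Pila–Wilkie 2006, §5: *"Now `(I)_0` … are both trivial"*): families of
functions of `0` variables are reparametrized by the identity of the point `(0,1)^0`.
[cite: PilaWilkie2006, §5] -/
theorem uniformReparam_zero {r : ℕ} (n m : ℕ) (F : Fin n → (Fin m → ℝ) → (Fin 0 → ℝ) → ℝ)
    (_hF : ∀ l, IsDefinableFamily L (F l))
    (hbd : ∀ l v, ∀ x ∈ Set.pi Set.univ (fun _ : Fin 0 => Ioo (0 : ℝ) 1), |F l v x| ≤ 1) :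
    ∃ (κ : Type) (_ : Fintype κ) (ψ : κ → (Fin m → ℝ) → (Fin 0 → ℝ) → (Fin 0 → ℝ)),
      (∀ j c, IsDefinableFamily L (fun v x => ψ j v x c)) ∧
      ∀ v, (∀ j, MapsTo (ψ j v) (Set.pi Set.univ fun _ : Fin 0 => Ioo (0 : ℝ) 1)
          (Set.pi Set.univ fun _ : Fin 0 => Ioo (0 : ℝ) 1)) ∧
        (⋃ j, ψ j v '' Set.pi Set.univ (fun _ : Fin 0 => Ioo (0 : ℝ) 1)) =
          Set.pi Set.univ (fun _ : Fin 0 => Ioo (0 : ℝ) 1) ∧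
        (∀ j c, ContDiffOn ℝ r (fun x => ψ j v x c) (Set.pi Set.univ fun _ : Fin 0 => Ioo (0 : ℝ) 1)) ∧
        (∀ j c, ∀ q ≤ r, ∀ x ∈ Set.pi Set.univ (fun _ : Fin 0 => Ioo (0 : ℝ) 1),
          ‖iteratedFDeriv ℝ q (fun x => ψ j v x c) x‖ ≤ 1) ∧
        (∀ j l, ContDiffOn ℝ r (fun x => F l v (ψ j v x)) (Set.pi Set.univ fun _ : Fin 0 => Ioo (0 : ℝ) 1)) ∧
        (∀ j l, ∀ q ≤ r, ∀ x ∈ Set.pi Set.univ (fun _ : Fin 0 => Ioo (0 : ℝ) 1),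
          ‖iteratedFDeriv ℝ q (fun x => F l v (ψ j v x)) x‖ ≤ 1) := by
  refine ⟨Unit, inferInstance, fun _ _ x => x, fun _ c => c.elim0, fun v => ?_⟩
  have hconst : ∀ l, (fun x : Fin 0 → ℝ => F l v x) = fun _ => F l v Fin.elim0 := fun l =>
    funext fun x => congrArg (F l v) (funext fun c => c.elim0)
  refine ⟨fun _ x hx => hx, ?_, fun _ c => c.elim0, fun _ c => c.elim0, fun _ l => ?_, fun _ l q _ x hx => ?_⟩
  · apply Subset.antisymm
    · exact iUnion_subset fun _ => by rintro _ ⟨x, hx, rfl⟩; exact hx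
    · intro x hx; exact mem_iUnion.mpr ⟨(), x, hx, rfl⟩
  · show ContDiffOn ℝ r (fun x : Fin 0 → ℝ => F l v x) _
    rw [hconst l]; exact contDiffOn_const
  · show ‖iteratedFDeriv ℝ q (fun x : Fin 0 → ℝ => F l v x) x‖ ≤ 1
    rw [hconst l]
    rcases q with _ | q
    · rw [norm_iteratedFDeriv_zero, Real.norm_eq_abs]
      have hx0 : (Fin.elim0 : Fin 0 → ℝ) ∈ Set.pi Set.univ (fun _ : Fin 0 => Ioo (0 : ℝ) 1) := fun c _ => c.elim0
      exact hbd l v _ hx0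
    · rw [iteratedFDeriv_succ_const]; simp

/-- **`UR(r, 1)`, the uniform `r`-reparametrization of one-variable definable families**
(Pila–Wilkie 2006, Cor. 3.6/5.1 with Cor. 5.2's uniformity; Wilkie 2015, Thm. 5.7): the
statement `UR(r, 1)` in the cube/Fréchet form used by `cellFibreParam`, derived from
`uniform_r_parametrization` (unary families on `(0,1)`) by the `1`-cube plumbing
`contDiffOn_norm_iteratedFDeriv_le_of_unary`. [cite: PilaWilkie2006, Cor. 3.6, Cor. 5.1–5.2] -/
theorem uniformReparam_one (hO : L.IsOMinimal ℝ)
    (hadd : (univ : Set ℝ).Definable L {v : Fin 3 → ℝ | v 0 + v 1 = v 2})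
    (hmul : (univ : Set ℝ).Definable L {v : Fin 3 → ℝ | v 0 * v 1 = v 2}) {r : ℕ} (hr : 1 ≤ r)
    (n m : ℕ) (F : Fin n → (Fin m → ℝ) → (Fin 1 → ℝ) → ℝ)
    (hF : ∀ l, IsDefinableFamily L (F l))
    (hbd : ∀ l v, ∀ x ∈ Set.pi Set.univ (fun _ : Fin 1 => Ioo (0 : ℝ) 1), |F l v x| ≤ 1) :
    ∃ (κ : Type) (_ : Fintype κ) (ψ : κ → (Fin m → ℝ) → (Fin 1 → ℝ) → (Fin 1 → ℝ)),
      (∀ j c, IsDefinableFamily L (fun v x => ψ j v x c)) ∧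
      ∀ v, (∀ j, MapsTo (ψ j v) (Set.pi Set.univ fun _ : Fin 1 => Ioo (0 : ℝ) 1)
          (Set.pi Set.univ fun _ : Fin 1 => Ioo (0 : ℝ) 1)) ∧
        (⋃ j, ψ j v '' Set.pi Set.univ (fun _ : Fin 1 => Ioo (0 : ℝ) 1)) =
          Set.pi Set.univ (fun _ : Fin 1 => Ioo (0 : ℝ) 1) ∧
        (∀ j c, ContDiffOn ℝ r (fun x => ψ j v x c) (Set.pi Set.univ fun _ : Fin 1 => Ioo (0 : ℝ) 1)) ∧
        (∀ j c, ∀ q ≤ r, ∀ x ∈ Set.pi Set.univ (fun _ : Fin 1 => Ioo (0 : ℝ) 1),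
          ‖iteratedFDeriv ℝ q (fun x => ψ j v x c) x‖ ≤ 1) ∧
        (∀ j l, ContDiffOn ℝ r (fun x => F l v (ψ j v x)) (Set.pi Set.univ fun _ : Fin 1 => Ioo (0 : ℝ) 1)) ∧
        (∀ j l, ∀ q ≤ r, ∀ x ∈ Set.pi Set.univ (fun _ : Fin 1 => Ioo (0 : ℝ) 1),
          ‖iteratedFDeriv ℝ q (fun x => F l v (ψ j v x)) x‖ ≤ 1) := by
  -- the unary families `G = (id, F_l(v, (y)))`
  set G : Fin (n + 1) → (Fin m → ℝ) → ℝ → ℝ :=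
    Fin.cons (fun _ y => y) (fun l v y => F l v (fun _ => y)) with hG
  have hGdef : ∀ l, IsDefinableFamily₁ L (G l) := by
    intro l
    refine Fin.cases ?_ (fun l' => ?_) l
    · simp only [hG, Fin.cons_zero]; exact IsDefinableFamily₁.id
    · simp only [hG, Fin.cons_succ]
      intro γ _ q t hq ht
      exact (hF l') γ q (fun u _ => t u) hq (fun _ => ht)
  have hG0 : ∀ v x, G 0 v x = x := fun v x => by simp [hG]
  have hcube1 : ∀ y : ℝ, y ∈ Ioo (0 : ℝ) 1 → (fun _ : Fin 1 => y) ∈ Set.pi Set.univ (fun _ : Fin 1 => Ioo (0 : ℝ) 1) :=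
    fun y hy _ _ => hy
  have hGbd : ∀ l v, ∀ y ∈ Ioo (0 : ℝ) 1, |G l v y| ≤ 1 := by
    intro l v y hy
    refine Fin.cases ?_ (fun l' => ?_) l
    · simp only [hG, Fin.cons_zero]; rw [abs_le]; exact ⟨by linarith [hy.1], hy.2.le⟩
    · simp only [hG, Fin.cons_succ]; exact hbd l' v _ (hcube1 y hy)
  obtain ⟨ι, hι, Φ, hΦdef, hΦ⟩ := uniform_r_parametrization hO hadd hmul G hGdef hG0 hGbd r hr
  refine ⟨ι, hι, fun i v x _ => Φ i v (x 0), fun i _ => ?_, fun v => ?_⟩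
  · intro γ _ q T hq hT
    exact (hΦdef i) γ q (fun u => T u 0) hq (hT 0)
  obtain ⟨hmaps, hCr, hbds, hcov⟩ := hΦ v
  have hunary : ∀ i l, ContDiffOn ℝ r (fun x : Fin 1 → ℝ => G l v (Φ i v (x 0)))
      (Set.pi Set.univ fun _ : Fin 1 => Ioo (0 : ℝ) 1) ∧
      ∀ q ≤ r, ∀ x ∈ Set.pi Set.univ (fun _ : Fin 1 => Ioo (0 : ℝ) 1),
        ‖iteratedFDeriv ℝ q (fun x : Fin 1 → ℝ => G l v (Φ i v (x 0))) x‖ ≤ 1 :=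
    fun i l => contDiffOn_norm_iteratedFDeriv_le_of_unary (f := fun y => G l v (Φ i v y)) (hCr i l) (hbds i l)
  refine ⟨fun i x hx _ _ => hmaps i (hx 0 (mem_univ _)), ?_, fun i _ => ?_, fun i _ => ?_, fun i l => ?_, fun i l => ?_⟩
  · apply Subset.antisymm
    · exact iUnion_subset fun i => by
        rintro _ ⟨x, hx, rfl⟩ c _
        exact hmaps i (hx 0 (mem_univ _))
    · intro y hy
      have hy0 : y 0 ∈ ⋃ i, Φ i v '' Ioo 0 1 := by rw [hcov]; exact hy 0 (mem_univ _)
      obtain ⟨i, x₀, hx₀, hx₀y⟩ := mem_iUnion.mp hy0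
      refine mem_iUnion.mpr ⟨i, fun _ => x₀, hcube1 x₀ hx₀, ?_⟩
      funext c
      rw [Subsingleton.elim c 0]
      exact hx₀y
  · have h := (hunary i 0).1
    simpa only [hG, Fin.cons_zero] using h
  · have h := (hunary i 0).2
    simpa only [hG, Fin.cons_zero] using h
  · have h := (hunary i l.succ).1
    simpa only [hG, Fin.cons_succ] using h
  · have h := (hunary i l.succ).2
    simpa only [hG, Fin.cons_succ] using h

end Low


end Literature.ModelTheory.ExponentialFields

end
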